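import Literature.NumberTheory.EllipticCurves.Rank1Residual.GVParityTwistTransportProofs
import Literature.NumberTheory.EllipticCurves.Rank1Residual.GVParityIsogenyProofs
import Summits.BirchSwinnertonDyer.Rank1Residual.Additive.X3BranchResidualCountOfCharacterFacts
import Literature.NumberTheory.GaloisRepresentations.DirichletCharacterOfGaloisCharacter
import HarnessLib

/-!
# Crux 3 `MazurMCOnCellB` (stmt-BirchSwinnertonDyer-19033), line `twistback` v4 — the TWIST-CHARACTER
# DICTIONARY, part 1 (transport): the characters of a rational line and of its quotient along the
# sign-equivariant identification `E^{(D)}[p] ≃ E[p]` (they pick up the quadratic character `χ_D`, as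
# EXPLICIT Dirichlet characters `φ·χ̄_D`, `ψ·χ̄_D`) and along the quotient isogeny `E → E/Φ₀` (they swap)

Width seat bsd-line-x2-p1-w3 (gen 8), cell `bsd-eis` (run/shared/lean/pub/bsd-eis/), 2026-08-28. HONEST FRAMING:
pure Galois-module / Dirichlet-character algebra; THEOREMS ONLY (no `def`, no named fact, no `sorry`); `--supports`
stmt-BirchSwinnertonDyer-19033; closes no stub by itself; no summit statement, no Mazur main conjecture and no BSD is
proved for any curve; 0 cells / labels / tiers move.

WHY (LEAD bsd-line-x2-p1 g10, `Cruxes/MazurMCOnCellB/Lines/twistback-lead-verdict-g10.md` §2/§4(2), PICKED.md LEAD g10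
block: "the twist-character dictionary (φ_{E^K} = φ_E χ_K) to make «c(E^K) = c(E)», «KL-flat ⟺ 3 ∤ h(D·d_K)» kernel
statements about E and K"). The door `…TwistbackKLFlatPartner.upperPartner_at_of_klFlat_partner` (p645525 §3) asks, for
every globally minimal model `Wd` of the twist `E^{(d_K)}`, for a curve `V′` isogenous to `Wd` carrying a rational line
`Φ₀′ ≤ V′[p]` which is RAMIFIED at `p` and EVEN, together with PRIMITIVE Dirichlet characters `φ′` (mod `m′`, `p ∣ m′`)
and `ψ′` (mod `d′`, `p ∤ d′`) with values in `𝔽_p` acting on `Φ₀′` and on `V′[p]/Φ₀′` in the binder shape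
`σ • Q = (φ′(χ_{m′}(σ))).val • Q`, `σ • Q − (ψ′(χ_{d′}(σ))).val • Q ∈ Φ₀′` — and then two conditions on the VALUES of
`φ′`, `ψ′` (KL-flatness, local balance). This file and its sequel (`…TwistLineCharactersPackage`) compute `φ′`, `ψ′`
from the characters `φ`, `ψ` of the given X2b curve `W` and a quadratic character `χ` of `ℚ(√D)`:

* §1 (character algebra, curve-free) `isPrimitive_changeLevel_mul_changeLevel` — characters with COPRIME conductors:
  `χ₁` primitive mod `n₁`, `χ₂` primitive mod `n₂`, `gcd(n₁,n₂) = 1` ⟹ `χ₁χ₂` (at level `n₁n₂`) is primitive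
  (Mathlib's `conductor_mul_dvd_lcm_conductor`, `conductor_inv`, `conductor_changeLevel`);
  `changeLevel_mul_changeLevel_apply_modNCyclotomicCharacter` / `…_apply_natCast` — its values at `χ_{n₁n₂}(σ)` and
  at EVERY natural number `a` are `χ₁(·)χ₂(·)` (the dictionary for the door's indicators `[φ′(ℓ) = ℓ̄]` and its
  KL-flat data: `φ′(ℓ) = φ(ℓ)χ̄(ℓ)`, `= φ(ℓ)` at `ℓ` split in `K`, `= 0` at `ℓ ∣ N`).
* §2 (transport along ANY sign-equivariant `e : E^{(D)}[p] ≃ E[p]`, `e(σT) = ±σe(T)` according as `σ√D = ±√D` — the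
  tree's `exists_signEquiv_of_twist`, Silverman X.5.4 — and ANY quadratic `ℤ`-valued character `χ` mod `N` with the
  radical relation `τ√D = χ(χ_N(τ))·√D`, e.g. the Gauss-sum characters of the tree): if `φ` (mod `m`) acts on the
  rational line `Φ₀ ≤ E[p]` and `ψ` (mod `d`) on `E[p]/Φ₀`, then `φ·χ̄` (level `m·N`, `χ̄ = χ mod p`) acts on
  `e⁻¹(Φ₀) ≤ E^{(D)}[p]` and `ψ·χ̄` (level `d·N`) on its quotient, in the door's binder shape —
  `smul_eq_twistChar_of_mem_map_symm`, `smul_sub_twistChar_mem_map_symm`.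
* §3 (GV's reduction `E′ = E/Φ`, p. 28, WITH CHARACTERS) `smul_eq_of_mem_range_of_ker_eq` /
  `smul_sub_mem_range_of_ker_eq` — along an equivariant `g : E[p] → E′[p]` with kernel the rational line `Φ₀` of
  characters `(φ, ψ)`, the image line `g(E[p])` has character `ψ` and ITS quotient has character `φ` (Weil pairing:
  `φψ = ω` on both curves, tree `X3Branch.natCast_mul_eq_modNCyclotomicCharacter_of_line`).

The sequel packages §2 with the tree's parity/ramification transports (`GVParityTwistTransportProofs`) into the two X2b
shapes (line ramified-odd ⟹ twist line ramified-even with `(φχ̄, ψχ̄)`; line unramified-even ⟹ twist line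
unramified-odd, then §3 along `Wd → Wd/e⁻¹(Φ₀)` ⟹ ramified-even with `(ψχ̄, φχ̄)`). NOT here: the supply of
`(N, χ, radical relation)` for a given `d_K`, the local `δ`-terms of the twist, the existence of admissible `K`.

References: [GreenbergVatsal2000] §2 p. 28 (`φψ = ω`; `E′ = E/Φ`); [SilvermanAEC2009] X.5 Cor. 5.4, III.8 (Weil
pairing); [Washington1997] Ch. 3 (Dirichlet characters as Galois characters, conductors).
-/

set_option autoImplicit false

-- `Summit.BirchSwinnertonDyer.BirchSwinnertonDyer.…`: the summit and its single sub-problem share a name.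
set_option linter.dupNamespace false

noncomputable section

open scoped Classical

open WeierstrassCurve NumberField IsDedekindDomain Field DirichletCharacter
  Literature.NumberTheory.EllipticCurves Literature.NumberTheory.GaloisRepresentations
  Literature.NumberTheory.EllipticCurves.Rank1Residual
  Summit.BirchSwinnertonDyer.Rank1Residual.X2.PrimeOrderCharacters
  Summit.BirchSwinnertonDyer.Rank1Residual.X2.ResidualLineCharacters
  Summit.BirchSwinnertonDyer.Rank1Residual.Additive

namespace Summit.BirchSwinnertonDyer.BirchSwinnertonDyer.Theorems.EisensteinPrimesMazurMCOnCellBTwistbackTwistLineCharacters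

/-! ## §1. Character algebra: products of characters with coprime conductors, and their values -/

/-- **Characters with coprime conductors multiply to a PRIMITIVE character**: if `χ₁` is primitive modulo `n₁`, `χ₂`
is primitive modulo `n₂` and `gcd(n₁, n₂) = 1`, then `χ₁χ₂`, read at level `n₁n₂`, is primitive (its conductor is
divisible by `n₁` because `χ₁ = (χ₁χ₂)·χ₂⁻¹` has conductor dividing `lcm(f(χ₁χ₂), n₂)`, and symmetrically; Mathlib's
`conductor_mul_dvd_lcm_conductor`, `conductor_inv`, `conductor_changeLevel`).
[cite: Washington1997, Ch. 3 (conductor of a product of characters of coprime conductors)] -/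
theorem isPrimitive_changeLevel_mul_changeLevel {R : Type*} [CommMonoidWithZero R] {n₁ n₂ : ℕ} [NeZero n₁]
    [NeZero n₂] {χ₁ : DirichletCharacter R n₁} {χ₂ : DirichletCharacter R n₂} (h₁ : χ₁.IsPrimitive)
    (h₂ : χ₂.IsPrimitive) (hcop : n₁.Coprime n₂) :
    (changeLevel (dvd_mul_right n₁ n₂) χ₁ * changeLevel (dvd_mul_left n₂ n₁) χ₂ :
      DirichletCharacter R (n₁ * n₂)).IsPrimitive := by
  set χ : DirichletCharacter R (n₁ * n₂) := changeLevel (dvd_mul_right n₁ n₂) χ₁ with hχ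
  set ψ : DirichletCharacter R (n₁ * n₂) := changeLevel (dvd_mul_left n₂ n₁) χ₂ with hψ
  have hχc : χ.conductor = n₁ := by rw [hχ, conductor_changeLevel]; exact h₁
  have hψc : ψ.conductor = n₂ := by rw [hψ, conductor_changeLevel]; exact h₂
  have h : χ.conductor.Coprime ψ.conductor := by rw [hχc, hψc]; exact hcop
  rw [isPrimitive_def]
  apply Nat.dvd_antisymm (conductor_dvd_level _)
  have hχd : χ.conductor ∣ (χ * ψ).conductor := by
    have h1 : χ = (χ * ψ) * ψ⁻¹ := by rw [mul_assoc, mul_inv_cancel, mul_one]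
    have h2 := conductor_mul_dvd_lcm_conductor (χ * ψ) ψ⁻¹
    rw [← h1, conductor_inv] at h2
    exact h.dvd_of_dvd_mul_right (h2.trans (Nat.lcm_dvd_mul _ _))
  have hψd : ψ.conductor ∣ (χ * ψ).conductor := by
    have h1 : ψ = (χ * ψ) * χ⁻¹ := by rw [mul_comm χ ψ, mul_assoc, mul_inv_cancel, mul_one]
    have h2 := conductor_mul_dvd_lcm_conductor (χ * ψ) χ⁻¹
    rw [← h1, conductor_inv] at h2
    exact h.symm.dvd_of_dvd_mul_right (h2.trans (Nat.lcm_dvd_mul _ _))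
  have h3 := h.mul_dvd_of_dvd_of_dvd hχd hψd
  rwa [hχc, hψc] at h3

/-- **Value of the product character at the cyclotomic character**: `(χ₁χ₂)(χ_{n₁n₂}(σ)) = χ₁(χ_{n₁}(σ))·χ₂(χ_{n₂}(σ))`
(`χ_{n₁n₂} ≡ χ_{nᵢ} (mod nᵢ)`, tree `cast_modNCyclotomicCharacter`). [cite: Washington1997, Ch. 3 (Dirichlet characters as Galois characters)] -/
theorem changeLevel_mul_changeLevel_apply_modNCyclotomicCharacter {R : Type*} [CommMonoidWithZero R] {n₁ n₂ : ℕ}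
    [NeZero n₁] [NeZero n₂] (χ₁ : DirichletCharacter R n₁) (χ₂ : DirichletCharacter R n₂)
    (σ : absoluteGaloisGroup ℚ) :
    (changeLevel (dvd_mul_right n₁ n₂) χ₁ * changeLevel (dvd_mul_left n₂ n₁) χ₂ : DirichletCharacter R (n₁ * n₂))
        ((modNCyclotomicCharacter ℚ (n₁ * n₂) σ : (ZMod (n₁ * n₂))ˣ) : ZMod (n₁ * n₂)) =
      χ₁ ((modNCyclotomicCharacter ℚ n₁ σ : (ZMod n₁)ˣ) : ZMod n₁) *
        χ₂ ((modNCyclotomicCharacter ℚ n₂ σ : (ZMod n₂)ˣ) : ZMod n₂) := by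
  rw [MulChar.mul_apply, changeLevel_eq_cast_of_dvd, changeLevel_eq_cast_of_dvd,
    cast_modNCyclotomicCharacter ℚ (dvd_mul_right n₁ n₂), cast_modNCyclotomicCharacter ℚ (dvd_mul_left n₂ n₁)]

/-- **Value of the product character at a natural number**: `(χ₁χ₂)(a) = χ₁(a)·χ₂(a)` for EVERY `a : ℕ` (for `a`
not coprime to `n₁n₂` both sides vanish, since `a` is then not coprime to `n₁` or to `n₂`). This is the dictionary for
the door's balance indicators `[φ′(ℓ) = ℓ̄]` and KL-flat data: `φ′(ℓ) = φ(ℓ)χ̄(ℓ)`. [cite: Washington1997, Ch. 3] -/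
theorem changeLevel_mul_changeLevel_apply_natCast {R : Type*} [CommMonoidWithZero R] {n₁ n₂ : ℕ} [NeZero n₁]
    [NeZero n₂] (χ₁ : DirichletCharacter R n₁) (χ₂ : DirichletCharacter R n₂) (a : ℕ) :
    (changeLevel (dvd_mul_right n₁ n₂) χ₁ * changeLevel (dvd_mul_left n₂ n₁) χ₂ : DirichletCharacter R (n₁ * n₂))
        (a : ZMod (n₁ * n₂)) = χ₁ (a : ZMod n₁) * χ₂ (a : ZMod n₂) := by
  by_cases ha : a.Coprime (n₁ * n₂)
  · have hu : ((ZMod.unitOfCoprime a ha : (ZMod (n₁ * n₂))ˣ) : ZMod (n₁ * n₂)) = (a : ZMod (n₁ * n₂)) :=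
      ZMod.coe_unitOfCoprime a ha
    rw [← hu, MulChar.mul_apply, changeLevel_eq_cast_of_dvd, changeLevel_eq_cast_of_dvd, hu,
      ZMod.cast_natCast (dvd_mul_right n₁ n₂), ZMod.cast_natCast (dvd_mul_left n₂ n₁)]
  · have hl : (changeLevel (dvd_mul_right n₁ n₂) χ₁ * changeLevel (dvd_mul_left n₂ n₁) χ₂ :
        DirichletCharacter R (n₁ * n₂)) (a : ZMod (n₁ * n₂)) = 0 :=
      MulChar.map_nonunit _ (fun h ↦ ha ((ZMod.isUnit_iff_coprime a (n₁ * n₂)).mp h))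
    rw [hl]
    by_cases h₁ : a.Coprime n₁
    · have h₂ : ¬ a.Coprime n₂ := fun h₂ ↦ ha (Nat.Coprime.mul_right h₁ h₂)
      rw [MulChar.map_nonunit χ₂ (fun h ↦ h₂ ((ZMod.isUnit_iff_coprime a n₂).mp h)), mul_zero]
    · rw [MulChar.map_nonunit χ₁ (fun h ↦ h₁ ((ZMod.isUnit_iff_coprime a n₁).mp h)), zero_mul]

/-- Reduction modulo `p` of an integer-valued character at the cyclotomic character: `χ̄(χ_N(σ)) = (χ(χ_N(σ)) mod p)`.
[folklore] -/
theorem ringHomComp_apply_eq_intCast {N : ℕ} [NeZero N] {p : ℕ} (χ : MulChar (ZMod N) ℤ) (a : ZMod N) :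
    (χ.ringHomComp (Int.castRingHom (ZMod p)) : DirichletCharacter (ZMod p) N) a = ((χ a : ℤ) : ZMod p) := by
  rw [MulChar.ringHomComp_apply, eq_intCast]

/-! ## §2. Transport of the line characters along a sign-equivariant `e : E^{(D)}[p] ≃ E[p]` -/

section SignEquiv

variable {W Wd : WeierstrassCurve ℚ} {p : ℕ} [hp : Fact p.Prime]

/-- Integer multiples of a `p`-torsion point depend only on the residue modulo `p`. [folklore] -/
theorem zsmul_eq_zsmul_of_intCast_eq (T : geomTorsion W (p : ℤ)) {a b : ℤ} (h : (a : ZMod p) = (b : ZMod p)) :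
    a • T = b • T := by
  have hpT : (p : ℤ) • T = 0 := by
    apply Subtype.ext
    rw [AddSubgroupClass.coe_zsmul, ZeroMemClass.coe_zero]
    exact (Submodule.mem_torsionBy_iff (p : ℤ) _).mp T.2
  obtain ⟨k, hk⟩ := (ZMod.intCast_eq_intCast_iff_dvd_sub a b p).mp h
  have hb : b = a + p * k := by linear_combination hk
  rw [hb, add_zsmul, mul_comm, mul_zsmul, hpT, zsmul_zero, add_zero]

variable (e : geomTorsion Wd (p : ℤ) ≃+ geomTorsion W (p : ℤ)) {D : ℚ}
  (hpos : ∀ σ : absoluteGaloisGroup ℚ, σ • geomSqrt D = geomSqrt D → ∀ T, e (σ • T) = σ • e T)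
  (hneg : ∀ σ : absoluteGaloisGroup ℚ, ¬ σ • geomSqrt D = geomSqrt D → ∀ T, e (σ • T) = -(σ • e T))
  (hD0 : D ≠ 0) {N : ℕ} [NeZero N] (χ : MulChar (ZMod N) ℤ) (hχ2 : χ.IsQuadratic)
  (hχ : ∀ τ : absoluteGaloisGroup ℚ,
    τ • geomSqrt D = ((χ (modNCyclotomicCharacter ℚ N τ : ZMod N) : ℤ) : AlgebraicClosure ℚ) * geomSqrt D)

omit hp in
include hD0 hχ2 hχ in
/-- **The sign of `σ` on `√D` is the value `χ(χ_N(σ)) = ±1`** (the radical relation `τ√D = χ(χ_N τ)√D` for a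
quadratic `χ`; `χ` of a unit is `±1`, and `√D ≠ −√D`). [cite: Washington1997, Ch. 3 (the character of a quadratic field)] -/
theorem apply_eq_one_and_smul_eq_or (σ : absoluteGaloisGroup ℚ) :
    (χ (modNCyclotomicCharacter ℚ N σ : ZMod N) = 1 ∧ σ • geomSqrt D = geomSqrt D) ∨
      (χ (modNCyclotomicCharacter ℚ N σ : ZMod N) = -1 ∧ ¬ σ • geomSqrt D = geomSqrt D) := by
  have hu : χ (modNCyclotomicCharacter ℚ N σ : ZMod N) ≠ 0 := by
    have h := IsUnit.map χ (modNCyclotomicCharacter ℚ N σ).isUnit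
    intro h0
    rw [h0] at h
    exact not_isUnit_zero h
  rcases hχ2 (modNCyclotomicCharacter ℚ N σ : ZMod N) with h0 | h1 | h1
  · exact absurd h0 hu
  · refine Or.inl ⟨h1, ?_⟩
    rw [hχ σ, h1, Int.cast_one, one_mul]
  · refine Or.inr ⟨h1, ?_⟩
    rw [hχ σ, h1, Int.cast_neg, Int.cast_one, neg_one_mul]
    exact fun h ↦ geomSqrt_ne_neg hD0 h.symm

include hpos hneg hD0 hχ2 hχ in
/-- **The line character of the twist is `φ·χ̄`.** If `φ` (mod `m`, values in `𝔽_p`) acts on `Φ₀ ≤ E[p]`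
(`σ • P = φ(χ_m σ) • P`), then on the line `e⁻¹(Φ₀) ≤ E^{(D)}[p]` every `σ ∈ Γ_ℚ` acts as the scalar
`(φ·χ̄)(χ_{mN}(σ)) = φ(χ_m σ)·χ(χ_N σ)`: `e(σT) = χ(χ_N σ)·σ e(T)` (Silverman X.5.4, `E^{(D)} ≅ E ⊗ χ_D`).
[cite: SilvermanAEC2009, X.5 Cor. 5.4] [cite: GreenbergVatsal2000, §2 p. 28 (the character φ of Φ)] -/
theorem smul_eq_twistChar_of_mem_map_symm {Φ₀ : AddSubgroup (geomTorsion W (p : ℤ))} {m : ℕ} [NeZero m]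
    (φ : DirichletCharacter (ZMod p) m)
    (hφ0 : ∀ (σ : absoluteGaloisGroup ℚ), ∀ P ∈ Φ₀,
      σ • P = (φ ((modNCyclotomicCharacter ℚ m σ : (ZMod m)ˣ) : ZMod m)).val • P)
    (σ : absoluteGaloisGroup ℚ) (T : geomTorsion Wd (p : ℤ)) (hT : T ∈ Φ₀.map e.symm.toAddMonoidHom) :
    σ • T = ((changeLevel (dvd_mul_right m N) φ *
        changeLevel (dvd_mul_left N m) (χ.ringHomComp (Int.castRingHom (ZMod p))) :
          DirichletCharacter (ZMod p) (m * N))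
        ((modNCyclotomicCharacter ℚ (m * N) σ : (ZMod (m * N))ˣ) : ZMod (m * N))).val • T := by
  obtain ⟨P, hP, rfl⟩ := AddSubgroup.mem_map.mp hT
  change σ • e.symm P = _ • e.symm P
  set a : ℕ := (φ ((modNCyclotomicCharacter ℚ m σ : (ZMod m)ˣ) : ZMod m)).val with ha
  set ε : ℤ := χ (modNCyclotomicCharacter ℚ N σ : ZMod N) with hε
  -- step 1: `σ` acts on `e⁻¹ P` as the integer `ε · a`
  have h1 : σ • e.symm P = (ε * (a : ℤ)) • e.symm P := by
    rcases apply_eq_one_and_smul_eq_or hD0 χ hχ2 hχ σ with ⟨h1, hfix⟩ | ⟨h1, hnfix⟩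
    · apply e.injective
      rw [hpos σ hfix, e.apply_symm_apply, hφ0 σ P hP, ← ha, show ε = 1 from hε.trans h1, one_mul,
        natCast_zsmul, map_nsmul, e.apply_symm_apply]
    · apply e.injective
      rw [hneg σ hnfix, e.apply_symm_apply, hφ0 σ P hP, ← ha, show ε = -1 from hε.trans h1, neg_one_mul,
        neg_zsmul, natCast_zsmul, map_neg, map_nsmul, e.apply_symm_apply]
  -- step 2: the value of `φ·χ̄` at `χ_{mN}(σ)` is `ε · a` in `𝔽_p`
  have h2 : ((changeLevel (dvd_mul_right m N) φ *
        changeLevel (dvd_mul_left N m) (χ.ringHomComp (Int.castRingHom (ZMod p))) :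
          DirichletCharacter (ZMod p) (m * N))
        ((modNCyclotomicCharacter ℚ (m * N) σ : (ZMod (m * N))ˣ) : ZMod (m * N))) =
      ((ε * (a : ℤ) : ℤ) : ZMod p) := by
    rw [changeLevel_mul_changeLevel_apply_modNCyclotomicCharacter, ringHomComp_apply_eq_intCast, ← hε,
      Int.cast_mul, Int.cast_natCast, ha, ZMod.natCast_zmod_val, mul_comm]
  -- step 3
  rw [h1, ← natCast_zsmul]
  refine zsmul_eq_zsmul_of_intCast_eq _ ?_
  rw [Int.cast_natCast, ZMod.natCast_zmod_val, h2]

include hpos hneg hD0 hχ2 hχ in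
/-- **The quotient character of the twist is `ψ·χ̄`.** If `ψ` (mod `d`, values in `𝔽_p`) acts on `E[p]/Φ₀`
(`σ • P − ψ(χ_d σ) • P ∈ Φ₀`), then `ψ·χ̄` (level `d·N`) acts on `E^{(D)}[p]/e⁻¹(Φ₀)`:
`σ • T − (ψ·χ̄)(χ_{dN}(σ)) • T ∈ e⁻¹(Φ₀)` for all `σ`, `T`. [cite: SilvermanAEC2009, X.5 Cor. 5.4]
[cite: GreenbergVatsal2000, §2 p. 28 (the character ψ of Ψ)] -/
theorem smul_sub_twistChar_mem_map_symm (Φ₀ : AddSubgroup (geomTorsion W (p : ℤ))) {d : ℕ} [NeZero d]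
    (ψ : DirichletCharacter (ZMod p) d)
    (hψ0 : ∀ (σ : absoluteGaloisGroup ℚ) (P : geomTorsion W (p : ℤ)),
      σ • P - (ψ ((modNCyclotomicCharacter ℚ d σ : (ZMod d)ˣ) : ZMod d)).val • P ∈ Φ₀)
    (σ : absoluteGaloisGroup ℚ) (T : geomTorsion Wd (p : ℤ)) :
    σ • T - ((changeLevel (dvd_mul_right d N) ψ *
        changeLevel (dvd_mul_left N d) (χ.ringHomComp (Int.castRingHom (ZMod p))) :
          DirichletCharacter (ZMod p) (d * N))
        ((modNCyclotomicCharacter ℚ (d * N) σ : (ZMod (d * N))ˣ) : ZMod (d * N))).val • T ∈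
      Φ₀.map e.symm.toAddMonoidHom := by
  set b : ℕ := (ψ ((modNCyclotomicCharacter ℚ d σ : (ZMod d)ˣ) : ZMod d)).val with hb
  set ε : ℤ := χ (modNCyclotomicCharacter ℚ N σ : ZMod N) with hε
  -- the value of `ψ·χ̄` at `χ_{dN}(σ)` is `ε · b` in `𝔽_p`, so its action is that of the integer `ε · b`
  have h2 : ((changeLevel (dvd_mul_right d N) ψ *
        changeLevel (dvd_mul_left N d) (χ.ringHomComp (Int.castRingHom (ZMod p))) :
          DirichletCharacter (ZMod p) (d * N))
        ((modNCyclotomicCharacter ℚ (d * N) σ : (ZMod (d * N))ˣ) : ZMod (d * N))) =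
      ((ε * (b : ℤ) : ℤ) : ZMod p) := by
    rw [changeLevel_mul_changeLevel_apply_modNCyclotomicCharacter, ringHomComp_apply_eq_intCast, ← hε,
      Int.cast_mul, Int.cast_natCast, hb, ZMod.natCast_zmod_val, mul_comm]
  have h3 : ((changeLevel (dvd_mul_right d N) ψ *
        changeLevel (dvd_mul_left N d) (χ.ringHomComp (Int.castRingHom (ZMod p))) :
          DirichletCharacter (ZMod p) (d * N))
        ((modNCyclotomicCharacter ℚ (d * N) σ : (ZMod (d * N))ˣ) : ZMod (d * N))).val • T =
      (ε * (b : ℤ)) • T := by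
    rw [← natCast_zsmul]
    refine zsmul_eq_zsmul_of_intCast_eq _ ?_
    rw [Int.cast_natCast, ZMod.natCast_zmod_val, h2]
  rw [h3]
  -- membership: apply `e` and land in `Φ₀`
  have key : e (σ • T - (ε * (b : ℤ)) • T) ∈ Φ₀ := by
    rcases apply_eq_one_and_smul_eq_or hD0 χ hχ2 hχ σ with ⟨h1, hfix⟩ | ⟨h1, hnfix⟩
    · rw [map_sub, hpos σ hfix, show ε = 1 from hε.trans h1, one_mul, natCast_zsmul, map_nsmul, hb]
      exact hψ0 σ (e T)
    · rw [map_sub, hneg σ hnfix, show ε = -1 from hε.trans h1, neg_one_mul, neg_zsmul, natCast_zsmul, map_neg,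
        map_nsmul, sub_neg_eq_add, neg_add_eq_sub, ← neg_sub, hb]
      exact neg_mem (hψ0 σ (e T))
  refine AddSubgroup.mem_map.mpr ⟨e (σ • T - (ε * (b : ℤ)) • T), key, ?_⟩
  change e.symm (e _) = _
  rw [e.symm_apply_apply]

end SignEquiv

/-! ## §3. Characters along the quotient isogeny `E → E′ = E/Φ₀` (GV p. 28 "`E′ = E/Φ`", WITH characters) -/

section Isogeny

variable {W W' : WeierstrassCurve ℚ} [W.IsElliptic] [W'.IsElliptic] {p : ℕ} [hp : Fact p.Prime]
  (g : geomTorsion W (p : ℤ) →+ geomTorsion W' (p : ℤ))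
  (hg : ∀ (σ : absoluteGaloisGroup ℚ) (P : geomTorsion W (p : ℤ)), g (σ • P) = σ • g P)

omit [W.IsElliptic] [W'.IsElliptic] in
include hg in
/-- **The image line `g(E[p]) ≅ E[p]/Φ₀` carries the quotient character `ψ`.** If `g : E[p] → E′[p]` is
`Γ_ℚ`-equivariant with kernel `Φ₀`, and `ψ` (mod `d`) acts on `E[p]/Φ₀` (`σ • P − ψ(χ_d σ) • P ∈ Φ₀`), then every
`σ` acts on `g(E[p])` as the scalar `ψ(χ_d(σ))`. [cite: GreenbergVatsal2000, §2 p. 28 (E′ = E/Φ, the image line Ψ)] -/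
theorem smul_eq_of_mem_range_of_ker_eq {Φ₀ : AddSubgroup (geomTorsion W (p : ℤ))} (hK : g.ker = Φ₀)
    {d : ℕ} [NeZero d] (ψ : DirichletCharacter (ZMod p) d)
    (hψ0 : ∀ (σ : absoluteGaloisGroup ℚ) (P : geomTorsion W (p : ℤ)),
      σ • P - (ψ ((modNCyclotomicCharacter ℚ d σ : (ZMod d)ˣ) : ZMod d)).val • P ∈ Φ₀)
    (σ : absoluteGaloisGroup ℚ) (Q : geomTorsion W' (p : ℤ)) (hQ : Q ∈ g.range) :
    σ • Q = (ψ ((modNCyclotomicCharacter ℚ d σ : (ZMod d)ˣ) : ZMod d)).val • Q := by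
  obtain ⟨P, rfl⟩ := hQ
  have h := hψ0 σ P
  rw [← hK, AddMonoidHom.mem_ker, map_sub, hg, map_nsmul, sub_eq_zero] at h
  exact h

include hg in
/-- **The quotient `E′[p]/g(E[p])` carries the line character `φ`** (`φψ = ω` on `E` and `ψ·ψ″ = ω` on `E′` for the
abstract character `ψ″` of `E′[p]/g(E[p])`, both by the Weil pairing — tree
`X3Branch.natCast_mul_eq_modNCyclotomicCharacter_of_line` — so `ψ″ = φ`): if `g : E[p] → E′[p]` is
`Γ_ℚ`-equivariant with kernel the rational line `Φ₀` of characters `(φ, ψ)`, then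
`σ • Q − φ(χ_m(σ)) • Q ∈ g(E[p])` for all `σ`, `Q ∈ E′[p]`. With §3's second shape and `X2/IsogenyLineType` (the image
line is RAMIFIED-EVEN at `p ‖ N`) this is the line datum of the KL-flat door on `V′ = Wd/e⁻¹(Φ₀)` with characters
`(ψχ̄, φχ̄)`. [cite: GreenbergVatsal2000, §2 p. 28 (φψ = ω; E′ = E/Φ)] [cite: SilvermanAEC2009, III.8 (Weil pairing, Galois equivariance)] -/
theorem smul_sub_mem_range_of_ker_eq {Φ₀ : AddSubgroup (geomTorsion W (p : ℤ))} (hΦ : IsRationalLine W p Φ₀)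
    (hK : g.ker = Φ₀) {m : ℕ} [NeZero m] (φ : DirichletCharacter (ZMod p) m)
    (hφ0 : ∀ (σ : absoluteGaloisGroup ℚ), ∀ P ∈ Φ₀,
      σ • P = (φ ((modNCyclotomicCharacter ℚ m σ : (ZMod m)ˣ) : ZMod m)).val • P)
    {d : ℕ} [NeZero d] (ψ : DirichletCharacter (ZMod p) d)
    (hψ0 : ∀ (σ : absoluteGaloisGroup ℚ) (P : geomTorsion W (p : ℤ)),
      σ • P - (ψ ((modNCyclotomicCharacter ℚ d σ : (ZMod d)ˣ) : ZMod d)).val • P ∈ Φ₀)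
    (σ : absoluteGaloisGroup ℚ) (Q : geomTorsion W' (p : ℤ)) :
    σ • Q - (φ ((modNCyclotomicCharacter ℚ m σ : (ZMod m)ˣ) : ZMod m)).val • Q ∈ g.range := by
  -- the image is a rational line of `E′[p]`
  have hKcard : Nat.card g.ker = p := by rw [hK]; exact hΦ.1
  have hΨ : IsRationalLine W' p g.range := isRationalLine_range g hg (Rank1Residual.natCard_geomTorsion W p) hKcard
  -- its abstract quotient character `ψ″`
  obtain ⟨d'', _, ψ'', -, -, hψ''⟩ := exists_character_quot hΨ
  -- Weil pairing on `E′` and on `E`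
  have hW' := X3Branch.natCast_mul_eq_modNCyclotomicCharacter_of_line hΨ
    (fun R hR ↦ smul_eq_of_mem_range_of_ker_eq g hg hK ψ hψ0 σ R hR) (hψ'' σ)
  have hW := X3Branch.natCast_mul_eq_modNCyclotomicCharacter_of_line hΦ (hφ0 σ) (hψ0 σ)
  rw [ZMod.natCast_zmod_val, ZMod.natCast_zmod_val] at hW hW'
  -- cancel the unit `ψ(χ_d σ)`: `ψ″(σ) = φ(σ)`
  have hu : IsUnit (ψ ((modNCyclotomicCharacter ℚ d σ : (ZMod d)ˣ) : ZMod d)) :=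
    IsUnit.map ψ (modNCyclotomicCharacter ℚ d σ).isUnit
  have heq : ψ'' ((modNCyclotomicCharacter ℚ d'' σ : (ZMod d'')ˣ) : ZMod d'') =
      φ ((modNCyclotomicCharacter ℚ m σ : (ZMod m)ˣ) : ZMod m) := by
    refine hu.mul_left_cancel ?_
    rw [hW', mul_comm, hW]
  have h := hψ'' σ Q
  rwa [heq] at h

end Isogeny

end Summit.BirchSwinnertonDyer.BirchSwinnertonDyer.Theorems.EisensteinPrimesMazurMCOnCellBTwistbackTwistLineCharacters

end
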